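import Literature.Barriers.Parity.SiegelZeroDichotomyPairHLSiegelModel
import Literature.Barriers.Parity.SiegelZeroDichotomyChowlaTools
import Literature.NumberTheory.LFunctions.SiegelExceptionalZeroBound
import HarnessLib

/-!
# Step (ii) of Tao–Teräväinen for `k = 2`, `ℓ = 0`: the architecture of Proposition 5.2
# (`TaoTeravainen2021_prop52_pair`), with the insertion of the sieve weight (5.1) proved

Topic `Literature/Barriers/Parity`, second layer under `SiegelZeroDichotomyPairHLSiegelModel.lean`
(whose named fact `Literature.Barriers.Parity.TaoTeravainen2021_prop52_pair` is Tao–Teräväinen's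
Proposition 5.2 at `k = 2`, `ℓ = 0`: `𝔼_{n ≤ x} Λ(n+h₁)Λ(n+h₂) ≈ 𝔼_{n ≤ x} Λ_Siegel(n+h₁)
Λ_Siegel(n+h₂)`, `Λ_Siegel = (χ ∗ log) ν`). The source proves Proposition 5.2 in three moves
(§5): (5.1) "`Λ - Λν` is supported on prime powers `p^j` with `p ≤ R` … one easily sees from the
triangle inequality that `𝔼 Λ(n+h₁)⋯Λ(n+h_k)⋯ ≈ 𝔼 Λν(n+h₁)⋯Λν(n+h_k)⋯`"; Lemma 5.1 "For
`n ≤ 2x`, we have the bounds `Λν(n) - Λ_Siegel(n) ≪ E(n) + F(n) + G(n)`" with the majorants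
(5.4)–(5.6); and "Multiplying these estimates together … By the triangle inequality and
relabeling, it thus suffices to establish the bounds (5.7), (5.8), (5.9)".
[cite: TaoTeravainen2021, §5 ((5.1), Lemma 5.1, proof of Proposition 5.2)]

This file records that layer, sorry-free:

* PROVED: (1.4) "`η ≪_ε q_χ^ε`" for Siegel zeros in the sense of Definition 1.4
  (`exists_siegelZero_quality_le`, from the tree's `Literature.NumberTheory.LFunctions.Siegel.exists_one_sub_realZero_ge`
  = Montgomery–Vaughan Cor. 11.15, itself proved from Siegel's theorem; the `ε = 1` logarithmic
  form is the tree's `exists_log_le_log_conductor_add` of `SiegelZeroDichotomyChowlaTools.lean`,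
  whose `IsSiegelZero.ne_one` is reused), the tool behind the hierarchy of scales
  `log η ≪ log q_χ ≪ log x` of §2.4;
* the objects: `Λν` = `sievedVonMangoldt ψ R` (with `ν(p^j) = (1 - ψ_{≤R}(p))²`, `= 1` for
  `p ≥ R`: `selbergSieve_prime_pow*`), the auxiliary scale `R₀ = x^{1/√log η}` ((2.5)) = `scaleR0`,
  and the majorants `E`, `F`, `G` of (5.4)–(5.6) = `errE`, `errF`, `errG` (exceptional primes
  `p*`: "`χ(p*) ≠ -1`", §2.3; the exponent `O(1)` of (5.5) is a parameter `A`), with their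
  `k = 2` instances `pairErrE`, `pairErrF`, `pairErrG` at `R = x^{1/log^{1/10} η}`, `R₀`,
  `D = x^{ε₀/20}` (`scaleD 2 ε₀ x`);
* PROVED: (5.1) at `k = 2`, `ℓ = 0` — `TaoTeravainen2021_eq51_pair`:
  `|𝔼_{n ≤ x} Λ(n+h₁)Λ(n+h₂) - 𝔼_{n ≤ x} Λν(n+h₁)Λν(n+h₂)| ≤ C / log^{1/20} η` for `η ≥ η₁`,
  `x ≥ q` (the difference is `O_ψ(R log³ x / x)`, `R ≤ x^{1/2}` once `log η ≥ 2^{10}`, and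
  `log η ≤ log x + O(1)` by (1.4));
* NAMED FACTS: Lemma 5.1 (`TaoTeravainen2021_lemma51_pair`) and the three bounds (5.7), (5.8),
  (5.9) (`TaoTeravainen2021_eq57_pair`, `_eq58_pair`, `_eq59_pair`), at `k = 2`, `ℓ = 0`;
* PROVED: the glue `TaoTeravainen2021_prop52_pair_of_stepTwo : lemma51_pair → eq57_pair →
  eq58_pair → eq59_pair → TaoTeravainen2021_prop52_pair` ((5.1) + "multiplying these estimates
  together" — `abs_mul_sub_mul_le_of_majorants`, the six integrands being exactly (5.7)–(5.9) at
  `(h₁, h₂)` and `(h₂, h₁)` — plus the bookkeeping of §2.1).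

## What the source prints (arXiv:2109.06291, §2.3–§2.5 and §5)

* §2.3: "We define an exceptional prime to be a prime `p*` such that `χ(p*) ≠ -1`; sums over `p*`
  … will always be understood to be over exceptional primes." `ℕ_{(≤z)}` = the `z`-smooth numbers,
  `f_{(≤z)} := f 1_{ℕ_{(≤z)}}`. (2.5): "`R₀ := x^{1/√log η}`". (1.4): "From Siegel's theorem we
  have the (ineffective) upper bound `η ≪_ε q_χ^ε`".
* §5 (5.1)–(5.2): "`Λ - Λν` is supported on prime powers `p^j` with `p ≤ R` and can be crudely
  bounded by `O(log² x)` on such powers. Since the number of such powers of size `O(x)` is crudely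
  bounded by `O(R log x)` …"; "`Λν(n), Λ_Siegel(n) ≪ τν(n) log x`".
* Lemma 5.1: "For `n ≤ 2x`, we have the bounds `Λν(n) - Λ_Siegel(n) ≪ E(n) + F(n) + G(n)` where
  `E(n) := (∑_{R₀ < p* ≤ √(2x)} 1_{p* ∣ n} + ∑_{R₀ < p ≤ √(2x)} 1_{p² ∣ n}) τν(n) log x`,
  `F(n) := (∑_{1 < d ≤ D : d ∣ n} τ_{(≤R₀)}(d)^{O(1)}) ν(n) log x`,
  `G(n) := ∑_{√(2x) < p* ≤ 2x/R^{1/2}} 1_{p* ∣ n} Λν(n/p*)`."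
* Proof of Proposition 5.2: "it thus suffices to establish the bounds
  (5.7) `𝔼_{n ≤ x} E(n+h₁) ∏_{j=2}^k (Λν+E+F+G)(n+h_j) ≈ 0` and
  (5.8) `𝔼_{n ≤ x} F(n+h₁) ∏_{j=2}^k (Λν+F+G)(n+h_j) ≈ 0` and
  (5.9) `𝔼_{n ≤ x} G(n+h₁) ∏_{j=2}^k (Λν+G)(n+h_j) ≈ 0`."

## Design notes

1. Quantifier shapes follow the layer above (after the fixed data `h₁, h₂, ψ`: `∃ ε₁ > 0`,
   `∀ ε₀ ∈ (0, ε₁]`, then — for (5.7), (5.8) — `∀ A` (the estimates hold for every fixed exponent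
   in `F_A`, with constants depending on it), then `∃ C η₁`, then all Siegel zeros with `η ≥ η₁`
   and all `x ∈ ℕ` in the range (1.7) at `k = 2`). Lemma 5.1 produces the exponent: for fixed `ψ`
   and `0 < ε₀ < 1`, `∃ A C η₁` (in the source `A` comes from Landreau's (3.10) with
   `D = x^{ε₀/20}`; "η sufficiently large" is used through `R₀ ≤ D`).
2. The averages in (5.7)–(5.9) are of non-negative terms, so "`≈ 0`" is the one-sided bound.
3. On the printed proof of Lemma 5.1, last case (`n = d p*` with `p* > √(2x)` exceptional): the
   display "`χ ∗ log(n) = Λ(n) + (1 + χ(p*))Λ(d)`" holds when `1 ∗ χ` vanishes at the divisors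
   `1 < e ∣ d`; in general `χ ∗ log(n) = (1∗χ)(d) log p* + (1 + χ(p*)) (χ ∗ log)(d)` and the extra
   terms (from the `R₀`-smooth part of `d`) are `≪ F(n)` by Landreau's inequality exactly as in
   the generic case — the LEMMA as stated (and vendored here) is unaffected.
4. NOT here: the proofs of Lemma 5.1 and of (5.7)–(5.9) (inputs: Landreau's inequality
   Lemma 3.1, the sieve bounds Lemma 3.2 and Lemma 3.4, Mertens' theorems, Corollary 3.6 — tree:
   `Literature.NumberTheory.LFunctions.TaoTeravainen2021_cor36_i` —, the divisor bound).
-/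

noncomputable section

open Filter Finset
open scoped ArithmeticFunction.vonMangoldt ArithmeticFunction.Moebius

namespace Literature.Barriers.Parity

/-! ### (1.4): the quality of a Siegel zero is `≪_ε q_χ^ε` (Siegel's theorem) -/

/-- The character of a Siegel zero satisfies `χ² = 1` (it is quadratic). [folklore] -/
theorem IsSiegelZero.sq_eq_one {q : ℕ} [NeZero q] {χ : DirichletCharacter ℂ q} {η : ℝ}
    (h : IsSiegelZero χ η) : χ ^ 2 = 1 :=
  MulChar.isQuadratic_iff_sq_eq_one.mp h.2.1

/-- **(1.4): "From Siegel's theorem we have the (ineffective) upper bound `η ≪_ε q_χ^ε` on the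
quality of a Siegel zero for any `ε > 0`."** For every `ε > 0` there is `C = C(ε) > 0` with
`η ≤ C q^ε` for every Siegel zero of quality `η` and conductor `q`: the zero `β = 1 - 1/(η log q)`
satisfies `1 - β ≥ c(ε) q^{-ε}` (tree: `Literature.NumberTheory.LFunctions.Siegel.exists_one_sub_realZero_ge`,
Montgomery–Vaughan Cor. 11.15, proved from Siegel's theorem), and `log q ≥ 1`.
[cite: TaoTeravainen2021, §1.1 (1.4)] -/
theorem exists_siegelZero_quality_le {ε : ℝ} (hε : 0 < ε) :
    ∃ C : ℝ, 0 < C ∧ ∀ (q : ℕ) [NeZero q] (χ : DirichletCharacter ℂ q) (η : ℝ),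
      IsSiegelZero χ η → η ≤ C * (q : ℝ) ^ ε := by
  obtain ⟨C₀, hC₀, h⟩ := Literature.NumberTheory.LFunctions.Siegel.exists_one_sub_realZero_ge hε
  refine ⟨1 / C₀, by positivity, fun q _ χ η hS => ?_⟩
  have hq3 : (3 : ℝ) ≤ q := by exact_mod_cast hS.three_le
  have hq0 : (0 : ℝ) < q := by linarith
  have hb := h q χ hS.sq_eq_one hS.ne_one (1 - 1 / (η * Real.log q)) hS.2.2.2
  have hlog : 1 < Real.log q :=
    (Real.lt_log_iff_exp_lt hq0).mpr (by linarith [Real.exp_one_lt_d9])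
  have hη : 0 < η := by linarith [hS.ten_le]
  have hqε : 0 < (q : ℝ) ^ ε := Real.rpow_pos_of_pos hq0 ε
  have hprod : 0 < η * Real.log q := by positivity
  -- `C₀ q^{-ε} ≤ 1/(η log q)`, i.e. `η log q ≤ q^ε / C₀`
  have h1 : C₀ * (q : ℝ) ^ (-ε) ≤ 1 / (η * Real.log q) := by linarith
  have h2 : η * Real.log q ≤ 1 / (C₀ * (q : ℝ) ^ (-ε)) := by
    have := one_div_le_one_div_of_le (by positivity) h1
    rwa [one_div_one_div] at this
  rw [Real.rpow_neg hq0.le, one_div, mul_inv, inv_inv] at h2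
  calc η ≤ η * Real.log q := le_mul_of_one_le_right hη.le hlog.le
    _ ≤ C₀⁻¹ * (q : ℝ) ^ ε := h2
    _ = 1 / C₀ * (q : ℝ) ^ ε := by rw [one_div]

namespace TaoTeravainen

/-! ### The Selberg sieve at prime powers -/

/-- A smooth cutoff is bounded: `|ψ| ≤ B` (continuous, and `0` off `[-1, 1]`). [folklore] -/
theorem IsSmoothCutoff.exists_abs_le {ψ : ℝ → ℝ} (hψ : IsSmoothCutoff ψ) :
    ∃ B : ℝ, 0 ≤ B ∧ ∀ u : ℝ, |ψ u| ≤ B := by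
  obtain ⟨B, hB⟩ := (isCompact_Icc : IsCompact (Set.Icc (-1 : ℝ) 1)).exists_bound_of_continuousOn
    hψ.contDiff.continuous.continuousOn
  refine ⟨max B 0, le_max_right _ _, fun u => ?_⟩
  by_cases hu : |u| ≤ 1
  · have hmem : u ∈ Set.Icc (-1 : ℝ) 1 := ⟨(abs_le.mp hu).1, (abs_le.mp hu).2⟩
    have := hB u hmem
    rw [Real.norm_eq_abs] at this
    exact this.trans (le_max_left _ _)
  · rw [hψ.eq_zero u (le_of_lt (not_le.mp hu)), abs_zero]
    exact le_max_right _ _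

/-- `ν(p^j) = (ψ(0) - ψ_{≤R}(p))²` for a prime power `p^j`, `j ≥ 1`: only the divisors `1` and `p`
are squarefree. [cite: TaoTeravainen2021, §2.5 (2.14)] -/
theorem selbergSieve_prime_pow (ψ : ℝ → ℝ) (R : ℝ) {p : ℕ} (hp : p.Prime) {j : ℕ} (hj : 1 ≤ j) :
    selbergSieve ψ R (p ^ j) = (ψ 0 - cutoffLE ψ R p) ^ 2 := by
  unfold selbergSieve
  congr 1
  rw [Nat.divisors_prime_pow hp, Finset.sum_map]
  obtain ⟨j, rfl⟩ : ∃ j', j = j' + 1 := ⟨j - 1, by omega⟩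
  rw [Finset.sum_range_succ', Finset.sum_range_succ']
  have hrest : ∑ i ∈ Finset.range j,
      (μ ((⟨(p ^ ·), Nat.pow_right_injective hp.two_le⟩ : ℕ ↪ ℕ) (i + 1 + 1)) : ℝ) *
        cutoffLE ψ R ((⟨(p ^ ·), Nat.pow_right_injective hp.two_le⟩ : ℕ ↪ ℕ) (i + 1 + 1)) = 0 := by
    refine Finset.sum_eq_zero fun i _ => ?_
    simp only [Function.Embedding.coeFn_mk]
    rw [ArithmeticFunction.moebius_apply_prime_pow hp (by omega), if_neg (by omega)]
    simp
  rw [hrest]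
  simp only [Function.Embedding.coeFn_mk, pow_zero, pow_one, zero_add,
    ArithmeticFunction.moebius_apply_one, ArithmeticFunction.moebius_apply_prime hp, cutoffLE_one]
  push_cast
  ring

/-- `ν(p^j) = (1 - ψ_{≤R}(p))²` for the cutoffs of §2.5. [cite: TaoTeravainen2021, §2.5 (2.14)] -/
theorem selbergSieve_prime_pow_of_isSmoothCutoff {ψ : ℝ → ℝ} (hψ : IsSmoothCutoff ψ) (R : ℝ)
    {p : ℕ} (hp : p.Prime) {j : ℕ} (hj : 1 ≤ j) :
    selbergSieve ψ R (p ^ j) = (1 - cutoffLE ψ R p) ^ 2 := by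
  rw [selbergSieve_prime_pow ψ R hp hj, hψ.eq_one 0 (by norm_num)]

/-- `ν(p^j) = 1` for a prime `p ≥ R > 1` ("`ν` is an upper bound sieve for `1_{(>R)}`": at
`R`-rough numbers `ν = 1`). [cite: TaoTeravainen2021, §2.5 (2.14)–(2.15)] -/
theorem selbergSieve_prime_pow_eq_one {ψ : ℝ → ℝ} (hψ : IsSmoothCutoff ψ) {R : ℝ} (hR : 1 < R)
    {p : ℕ} (hp : p.Prime) {j : ℕ} (hj : 1 ≤ j) (hpR : R ≤ p) :
    selbergSieve ψ R (p ^ j) = 1 := by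
  rw [selbergSieve_prime_pow_of_isSmoothCutoff hψ R hp hj, cutoffLE_eq_zero_of_le hψ hR hpR]
  norm_num

/-- `ν(p^j) ≤ (1 + B)²` when `|ψ| ≤ B`. [cite: TaoTeravainen2021, §2.5 (2.14)] -/
theorem selbergSieve_prime_pow_le {ψ : ℝ → ℝ} (hψ : IsSmoothCutoff ψ) {B : ℝ}
    (hB : ∀ u : ℝ, |ψ u| ≤ B) (R : ℝ) {p : ℕ} (hp : p.Prime) {j : ℕ} (hj : 1 ≤ j) :
    selbergSieve ψ R (p ^ j) ≤ (1 + B) ^ 2 := by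
  rw [selbergSieve_prime_pow_of_isSmoothCutoff hψ R hp hj]
  have h := abs_le.mp (hB (Real.log p / Real.log R))
  unfold cutoffLE
  refine sq_le_sq' ?_ ?_ <;> linarith [h.1, h.2]

/-- **`Λν` — the von Mangoldt function weighted by the Selberg sieve** ((5.1): "`Λ - Λν` is
supported on prime powers `p^j` with `p ≤ R`"). [cite: TaoTeravainen2021, §5 (5.1)] -/
def sievedVonMangoldt (ψ : ℝ → ℝ) (R : ℝ) (n : ℕ) : ℝ :=
  Λ n * selbergSieve ψ R n

/-- `Λν ≥ 0`. [cite: TaoTeravainen2021, §5 (5.1)] -/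
theorem sievedVonMangoldt_nonneg (ψ : ℝ → ℝ) (R : ℝ) (n : ℕ) : 0 ≤ sievedVonMangoldt ψ R n :=
  mul_nonneg ArithmeticFunction.vonMangoldt_nonneg (selbergSieve_nonneg ψ R n)

/-- `Λν(n) ≤ (1 + B)² log n` when `|ψ| ≤ B` (`Λν` vanishes off prime powers, and `ν(p^j) ≤ (1+B)²`).
[cite: TaoTeravainen2021, §5 (5.1)–(5.2)] -/
theorem sievedVonMangoldt_le {ψ : ℝ → ℝ} (hψ : IsSmoothCutoff ψ) {B : ℝ}
    (hB : ∀ u : ℝ, |ψ u| ≤ B) (R : ℝ) (n : ℕ) :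
    sievedVonMangoldt ψ R n ≤ (1 + B) ^ 2 * Real.log n := by
  unfold sievedVonMangoldt
  by_cases hpp : IsPrimePow n
  · obtain ⟨p, k, hp, hk, rfl⟩ := (isPrimePow_nat_iff _).mp hpp
    have hν := selbergSieve_prime_pow_le hψ hB R hp hk
    have hν0 := selbergSieve_nonneg ψ R (p ^ k)
    have hΛ : Λ (p ^ k) ≤ Real.log ((p ^ k : ℕ) : ℝ) := ArithmeticFunction.vonMangoldt_le_log
    have hΛ0 : 0 ≤ Λ (p ^ k) := ArithmeticFunction.vonMangoldt_nonneg
    calc Λ (p ^ k) * selbergSieve ψ R (p ^ k) ≤ Real.log ((p ^ k : ℕ) : ℝ) * (1 + B) ^ 2 :=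
          mul_le_mul hΛ hν hν0 ((hΛ0.trans hΛ))
      _ = (1 + B) ^ 2 * Real.log ((p ^ k : ℕ) : ℝ) := by ring
  · rw [ArithmeticFunction.vonMangoldt_eq_zero_iff.mpr hpp, zero_mul]
    exact mul_nonneg (sq_nonneg _) (Real.log_natCast_nonneg n)

/-- `Λν(p) = log p = Λ(p)` at a prime `p ≥ R > 1` (the sieve does not see `R`-rough primes).
[cite: TaoTeravainen2021, §5 (5.1) and (2.15)] -/
theorem sievedVonMangoldt_prime {ψ : ℝ → ℝ} (hψ : IsSmoothCutoff ψ) {R : ℝ} (hR : 1 < R)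
    {p : ℕ} (hp : p.Prime) (hpR : R ≤ p) : sievedVonMangoldt ψ R p = Real.log p := by
  unfold sievedVonMangoldt
  have h := selbergSieve_prime_pow_eq_one hψ hR hp (le_refl 1) (by simpa using hpR)
  rw [pow_one] at h
  rw [h, mul_one, ArithmeticFunction.vonMangoldt_apply_prime hp]

/-- **(5.1), pointwise**: "`Λ - Λν` is supported on prime powers `p^j` with `p ≤ R`" — precisely,
`|Λ(n) - Λν(n)| ≤ (1 + (1+B)²) log n · 1_{n = p^j, p < R}` (`ν(p^j) = 1` for `p ≥ R`, and
`|1 - ν| ≤ 1 + (1+B)²` always). [cite: TaoTeravainen2021, §5 (5.1)] -/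
theorem abs_vonMangoldt_sub_sieved_le {ψ : ℝ → ℝ} (hψ : IsSmoothCutoff ψ) {B : ℝ}
    (hB : ∀ u : ℝ, |ψ u| ≤ B) {R : ℝ} (hR : 1 < R) (n : ℕ) :
    |Λ n - sievedVonMangoldt ψ R n| ≤
      (1 + (1 + B) ^ 2) * Real.log n *
        (if IsPrimePow n ∧ (n.minFac : ℝ) < R then 1 else 0) := by
  unfold sievedVonMangoldt
  by_cases hpp : IsPrimePow n
  · obtain ⟨p, k, hp, hk, rfl⟩ := (isPrimePow_nat_iff _).mp hpp
    simp only [hp.pow_minFac hk.ne']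
    by_cases hpR : (p : ℝ) < R
    · rw [if_pos ⟨hpp, hpR⟩, mul_one]
      have hν := selbergSieve_prime_pow_le hψ hB R hp hk
      have hν0 := selbergSieve_nonneg ψ R (p ^ k)
      have hΛ : Λ (p ^ k) ≤ Real.log ((p ^ k : ℕ) : ℝ) := ArithmeticFunction.vonMangoldt_le_log
      have hΛ0 : 0 ≤ Λ (p ^ k) := ArithmeticFunction.vonMangoldt_nonneg
      rw [show Λ (p ^ k) - Λ (p ^ k) * selbergSieve ψ R (p ^ k) =
          Λ (p ^ k) * (1 - selbergSieve ψ R (p ^ k)) by ring, abs_mul, abs_of_nonneg hΛ0]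
      have h1 : |1 - selbergSieve ψ R (p ^ k)| ≤ 1 + (1 + B) ^ 2 := by
        rw [abs_le]
        constructor <;> linarith
      calc Λ (p ^ k) * |1 - selbergSieve ψ R (p ^ k)| ≤ Real.log ((p ^ k : ℕ) : ℝ) * (1 + (1 + B) ^ 2) :=
            mul_le_mul hΛ h1 (abs_nonneg _) (hΛ0.trans hΛ)
        _ = (1 + (1 + B) ^ 2) * Real.log ((p ^ k : ℕ) : ℝ) := by ring
    · rw [if_neg (fun h => hpR h.2), mul_zero,
        selbergSieve_prime_pow_eq_one hψ hR hp hk (not_lt.mp hpR), mul_one, sub_self, abs_zero]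
  · rw [ArithmeticFunction.vonMangoldt_eq_zero_iff.mpr hpp, zero_mul, sub_zero, abs_zero]
    have : 0 ≤ Real.log (n : ℝ) := Real.log_natCast_nonneg n
    split_ifs <;> positivity

/-- The prime powers `p^j ≤ M` (`j ≥ 1`) with `p < R` number at most `(⌊R⌋ + 1)(log₂ M + 1)`
("the number of such powers of size `O(x)` is crudely bounded by `O(R log x)`").
[cite: TaoTeravainen2021, §5 (5.1)] -/
theorem card_primePow_lt_le (M : ℕ) (R : ℝ) :
    #((Finset.range (M + 1)).filter fun m => IsPrimePow m ∧ (m.minFac : ℝ) < R) ≤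
      (⌊R⌋₊ + 1) * (Nat.log 2 M + 1) := by
  classical
  have hsub : (Finset.range (M + 1)).filter (fun m => IsPrimePow m ∧ (m.minFac : ℝ) < R) ⊆
      ((Finset.range (⌊R⌋₊ + 1)) ×ˢ (Finset.range (Nat.log 2 M + 1))).image
        fun pk => pk.1 ^ (pk.2 + 1) := by
    intro m hm
    rw [Finset.mem_filter, Finset.mem_range] at hm
    obtain ⟨hmM, hpp, hmin⟩ := hm
    obtain ⟨p, k, hp, hk, rfl⟩ := (isPrimePow_nat_iff _).mp hpp
    rw [hp.pow_minFac hk.ne'] at hmin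
    refine Finset.mem_image.mpr ⟨(p, k - 1), Finset.mem_product.mpr ⟨?_, ?_⟩, ?_⟩
    · rw [Finset.mem_range, Nat.lt_succ_iff]
      exact Nat.le_floor hmin.le
    · rw [Finset.mem_range, Nat.lt_succ_iff]
      have h2k : 2 ^ k ≤ M := by
        calc 2 ^ k ≤ p ^ k := Nat.pow_le_pow_left hp.two_le k
          _ ≤ M := by omega
      have := Nat.le_log_of_pow_le one_lt_two h2k
      omega
    · simp only
      rw [Nat.sub_add_cancel hk]
  calc _ ≤ #(((Finset.range (⌊R⌋₊ + 1)) ×ˢ (Finset.range (Nat.log 2 M + 1))).image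
          fun pk => pk.1 ^ (pk.2 + 1)) := Finset.card_le_card hsub
    _ ≤ #((Finset.range (⌊R⌋₊ + 1)) ×ˢ (Finset.range (Nat.log 2 M + 1))) := Finset.card_image_le
    _ = (⌊R⌋₊ + 1) * (Nat.log 2 M + 1) := by
        rw [Finset.card_product, Finset.card_range, Finset.card_range]

/-- `R = x^{1/log^{1/10} η} ≤ x^{1/2}` once `log η ≥ 2^{10}` (and `x ≥ 1`).
[cite: TaoTeravainen2021, §2.4 (2.3)] -/
theorem pairScaleR_le_sqrt {η x : ℝ} (hη : Real.exp 1024 ≤ η) (hx : 1 ≤ x) :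
    pairScaleR η x ≤ Real.sqrt x := by
  have hη0 : 0 < η := (Real.exp_pos _).trans_le hη
  have hlog : (1024 : ℝ) ≤ Real.log η := by
    rw [← Real.log_exp 1024]
    exact Real.log_le_log (Real.exp_pos _) hη
  have h2 : (2 : ℝ) ≤ Real.log η ^ ((1 : ℝ) / 10) := by
    have h1024 : ((1024 : ℝ)) ^ ((1 : ℝ) / 10) = 2 := by
      rw [show (1024 : ℝ) = 2 ^ (10 : ℕ) by norm_num, show ((1 : ℝ) / 10) = ((10 : ℕ) : ℝ)⁻¹ by norm_num,
        Real.pow_rpow_inv_natCast (by norm_num) (by norm_num)]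
    rw [← h1024]
    exact Real.rpow_le_rpow (by norm_num) hlog (by norm_num)
  unfold pairScaleR
  rw [Real.sqrt_eq_rpow]
  refine Real.rpow_le_rpow_of_exponent_le hx ?_
  exact one_div_le_one_div_of_le two_pos h2

/-- The pair version of the pointwise bound: for `log a, log b ≤ L`,
`|Λ(a)Λ(b) - Λν(a)Λν(b)| ≤ (1 + (1+B)²)² L² (1_{a = p^j, p<R} + 1_{b = p^j, p<R})`
(`ΛΛ - ΛνΛν = (Λ - Λν)Λ + Λν(Λ - Λν)`, `Λ ≤ log`, `Λν ≤ (1+B)² log`).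
[cite: TaoTeravainen2021, §5 (5.1)] -/
theorem abs_pair_sub_sievedPair_le {ψ : ℝ → ℝ} (hψ : IsSmoothCutoff ψ) {B : ℝ}
    (hB : ∀ u : ℝ, |ψ u| ≤ B) {R : ℝ} (hR : 1 < R) {L : ℝ} {a b : ℕ}
    (ha : Real.log a ≤ L) (hb : Real.log b ≤ L) :
    |Λ a * Λ b - sievedVonMangoldt ψ R a * sievedVonMangoldt ψ R b| ≤
      (1 + (1 + B) ^ 2) ^ 2 * L ^ 2 *
        ((if IsPrimePow a ∧ (a.minFac : ℝ) < R then (1 : ℝ) else 0) +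
          (if IsPrimePow b ∧ (b.minFac : ℝ) < R then (1 : ℝ) else 0)) := by
  have hda := abs_vonMangoldt_sub_sieved_le hψ hB hR a
  have hdb := abs_vonMangoldt_sub_sieved_le hψ hB hR b
  have hνa : sievedVonMangoldt ψ R a ≤ (1 + B) ^ 2 * Real.log a := sievedVonMangoldt_le hψ hB R a
  set K : ℝ := (1 + B) ^ 2 with hK
  set ιa : ℝ := (if IsPrimePow a ∧ (a.minFac : ℝ) < R then (1 : ℝ) else 0) with hιa
  set ιb : ℝ := (if IsPrimePow b ∧ (b.minFac : ℝ) < R then (1 : ℝ) else 0) with hιb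
  have hιa0 : 0 ≤ ιa := by rw [hιa]; split_ifs <;> norm_num
  have hιb0 : 0 ≤ ιb := by rw [hιb]; split_ifs <;> norm_num
  have hK0 : 0 ≤ K := by rw [hK]; positivity
  have hK0' : 0 ≤ 1 + K := by linarith
  have ha0 : 0 ≤ Real.log a := Real.log_natCast_nonneg _
  have hb0 : 0 ≤ Real.log b := Real.log_natCast_nonneg _
  have hL0 : 0 ≤ L := ha0.trans ha
  have hΛb : Λ b ≤ Real.log b := ArithmeticFunction.vonMangoldt_le_log
  have hΛb0 : 0 ≤ Λ b := ArithmeticFunction.vonMangoldt_nonneg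
  have hνa0 : 0 ≤ sievedVonMangoldt ψ R a := sievedVonMangoldt_nonneg ψ R _
  have key : Λ a * Λ b - sievedVonMangoldt ψ R a * sievedVonMangoldt ψ R b =
      (Λ a - sievedVonMangoldt ψ R a) * Λ b +
        sievedVonMangoldt ψ R a * (Λ b - sievedVonMangoldt ψ R b) := by
    ring
  rw [key]
  have hc1 : 1 + K ≤ (1 + K) ^ 2 := by nlinarith
  have hc2 : K * (1 + K) ≤ (1 + K) ^ 2 := by nlinarith
  have hA : 0 ≤ L ^ 2 * ιa := by positivity
  have hB' : 0 ≤ L ^ 2 * ιb := by positivity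
  calc |(Λ a - sievedVonMangoldt ψ R a) * Λ b +
          sievedVonMangoldt ψ R a * (Λ b - sievedVonMangoldt ψ R b)|
      ≤ |Λ a - sievedVonMangoldt ψ R a| * Λ b +
          sievedVonMangoldt ψ R a * |Λ b - sievedVonMangoldt ψ R b| := by
        refine (abs_add_le _ _).trans (le_of_eq ?_)
        rw [abs_mul, abs_mul, abs_of_nonneg hΛb0, abs_of_nonneg hνa0]
    _ ≤ ((1 + K) * Real.log a * ιa) * Real.log b +
          (K * Real.log a) * ((1 + K) * Real.log b * ιb) :=
        add_le_add (mul_le_mul hda hΛb hΛb0 (by positivity))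
          (mul_le_mul hνa hdb (abs_nonneg _) (by positivity))
    _ ≤ ((1 + K) * L * ιa) * L + (K * L) * ((1 + K) * L * ιb) := by
        refine add_le_add ?_ ?_
        · exact mul_le_mul
            (mul_le_mul_of_nonneg_right (mul_le_mul_of_nonneg_left ha hK0') hιa0) hb hb0
            (mul_nonneg (mul_nonneg hK0' hL0) hιa0)
        · exact mul_le_mul (mul_le_mul_of_nonneg_left ha hK0)
            (mul_le_mul_of_nonneg_right (mul_le_mul_of_nonneg_left hb hK0') hιb0)
            (mul_nonneg (mul_nonneg hK0' hb0) hιb0) (mul_nonneg hK0 hL0)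
    _ = (1 + K) * (L ^ 2 * ιa) + (K * (1 + K)) * (L ^ 2 * ιb) := by ring
    _ ≤ (1 + K) ^ 2 * (L ^ 2 * ιa) + (1 + K) ^ 2 * (L ^ 2 * ιb) :=
        add_le_add (mul_le_mul_of_nonneg_right hc1 hA) (mul_le_mul_of_nonneg_right hc2 hB')
    _ = (1 + K) ^ 2 * L ^ 2 * (ιa + ιb) := by ring

/-- Shifted count: `∑_{1 ≤ n ≤ x} 1_{n + h = p^j, p < R} ≤ (⌊R⌋ + 1)(log₂ M + 1)` for `x + h ≤ M`.
[cite: TaoTeravainen2021, §5 (5.1)] -/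
theorem sum_indicator_primePow_lt_le (R : ℝ) {x h M : ℕ} (hM : x + h ≤ M) :
    ∑ n ∈ Icc 1 x, (if IsPrimePow (n + h) ∧ ((n + h).minFac : ℝ) < R then (1 : ℝ) else 0) ≤
      (((⌊R⌋₊ + 1) * (Nat.log 2 M + 1) : ℕ) : ℝ) := by
  classical
  rw [Finset.sum_boole]
  have hinj : #((Icc 1 x).filter fun n => IsPrimePow (n + h) ∧ (((n + h).minFac : ℕ) : ℝ) < R) ≤
      #((Finset.range (M + 1)).filter fun m => IsPrimePow m ∧ (m.minFac : ℝ) < R) := by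
    refine Finset.card_le_card_of_injOn (fun n => n + h) (fun n hn => ?_) ?_
    · rw [Finset.mem_coe, Finset.mem_filter, Finset.mem_Icc] at hn
      rw [Finset.mem_coe, Finset.mem_filter, Finset.mem_range]
      exact ⟨show n + h < M + 1 by omega, hn.2⟩
    · intro a _ b _ hab
      simpa using hab
  exact_mod_cast hinj.trans (card_primePow_lt_le M R)

/-- `log⁴ x ≤ 16⁴ √x` for `x ≥ 1` (from `log x ≤ 16 x^{1/16}`). [folklore] -/
theorem log_pow_four_le_sqrt {x : ℝ} (hx : 1 ≤ x) : Real.log x ^ 4 ≤ 16 ^ 4 * Real.sqrt x := by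
  have hx0 : 0 < x := by linarith
  have h16 : Real.log x ≤ 16 * x ^ ((1 : ℝ) / 16) := by
    have := Real.log_le_rpow_div hx0.le (by norm_num : (0 : ℝ) < 1 / 16)
    linarith [show x ^ ((1 : ℝ) / 16) / (1 / 16) = 16 * x ^ ((1 : ℝ) / 16) by ring]
  have hpow : (x ^ ((1 : ℝ) / 16)) ^ 4 = x ^ ((1 : ℝ) / 4) := by
    rw [← Real.rpow_natCast, ← Real.rpow_mul hx0.le]
    norm_num
  have hquarter : x ^ ((1 : ℝ) / 4) ≤ Real.sqrt x := by
    rw [Real.sqrt_eq_rpow]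
    exact Real.rpow_le_rpow_of_exponent_le hx (by norm_num)
  have hlx0 : 0 ≤ Real.log x := Real.log_nonneg hx
  calc Real.log x ^ 4 ≤ (16 * x ^ ((1 : ℝ) / 16)) ^ 4 := by gcongr
    _ = 16 ^ 4 * (x ^ ((1 : ℝ) / 16)) ^ 4 := by ring
    _ = 16 ^ 4 * x ^ ((1 : ℝ) / 4) := by rw [hpow]
    _ ≤ 16 ^ 4 * Real.sqrt x := by linarith

/-- The crude count `(⌊R⌋ + 1)(log₂ M + 1) ≤ 6 √x · L` when `R ≤ √x`, `√x ≥ 1` and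
`1 ≤ L`, `log M ≤ L`. [folklore] -/
theorem natCount_le {R x L : ℝ} {M : ℕ} (hR0 : 0 ≤ R) (hR : R ≤ Real.sqrt x)
    (hsqrt1 : 1 ≤ Real.sqrt x) (hL1 : 1 ≤ L) (hLM : Real.log M ≤ L) :
    (((⌊R⌋₊ + 1) * (Nat.log 2 M + 1) : ℕ) : ℝ) ≤ 6 * Real.sqrt x * L := by
  have hfloor : (⌊R⌋₊ : ℝ) ≤ R := Nat.floor_le hR0
  have h1 : ((⌊R⌋₊ + 1 : ℕ) : ℝ) ≤ 2 * Real.sqrt x := by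
    push_cast
    linarith
  have hlog2 : ((Nat.log 2 M : ℕ) : ℝ) ≤ 2 * L := by
    have h1' : ((Nat.log 2 M : ℕ) : ℝ) ≤ Real.logb 2 M := Real.natLog_le_logb _ _
    rw [Real.logb] at h1'
    have hl2 : (1 / 2 : ℝ) < Real.log 2 := by
      have := Real.log_two_gt_d9
      linarith
    have h2' : ((Nat.log 2 M : ℕ) : ℝ) * Real.log 2 ≤ Real.log M :=
      (le_div_iff₀ (by linarith)).mp h1'
    have h0 : (0 : ℝ) ≤ ((Nat.log 2 M : ℕ) : ℝ) := Nat.cast_nonneg _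
    nlinarith
  have h2 : ((Nat.log 2 M + 1 : ℕ) : ℝ) ≤ 3 * L := by
    push_cast
    linarith
  rw [Nat.cast_mul]
  calc ((⌊R⌋₊ + 1 : ℕ) : ℝ) * ((Nat.log 2 M + 1 : ℕ) : ℝ) ≤ (2 * Real.sqrt x) * (3 * L) :=
        mul_le_mul h1 h2 (Nat.cast_nonneg _) (by positivity)
    _ = 6 * Real.sqrt x * L := by ring

/-- `log^{1/20} η ≤ (1 + |log C|) log x` when `η ≤ C x`, `log η ≥ 1`, `log x ≥ 1`. [folklore] -/
theorem rpow_log_le_of_le_mul {η C x : ℝ} (hη0 : 0 < η) (hC : 0 < C) (hx0 : 0 < x)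
    (hlogx : 1 ≤ Real.log x) (hlogη : 1 ≤ Real.log η) (hηx : η ≤ C * x) :
    Real.log η ^ ((1 : ℝ) / 20) ≤ (1 + |Real.log C|) * Real.log x := by
  have habs : 0 ≤ |Real.log C| := abs_nonneg _
  calc Real.log η ^ ((1 : ℝ) / 20) ≤ Real.log η ^ (1 : ℝ) :=
        Real.rpow_le_rpow_of_exponent_le hlogη (by norm_num)
    _ = Real.log η := Real.rpow_one _
    _ ≤ Real.log (C * x) := Real.log_le_log hη0 hηx
    _ = Real.log C + Real.log x := Real.log_mul hC.ne' hx0.ne'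
    _ ≤ |Real.log C| + Real.log x := by linarith [le_abs_self (Real.log C)]
    _ ≤ |Real.log C| * Real.log x + Real.log x := by
        linarith [le_mul_of_one_le_right habs hlogx]
    _ = (1 + |Real.log C|) * Real.log x := by ring

end TaoTeravainen

open TaoTeravainen

/-! ### (5.1): inserting the Selberg sieve, proved -/

/-- **Tao–Teräväinen 2022, (5.1) for `k = 2`, `ℓ = 0` (inserting the Selberg sieve), PROVED.**
"Observe that `Λ - Λν` is supported on prime powers `p^j` with `p ≤ R` and can be crudely bounded
by `O(log² x)` on such powers. Since the number of such powers of size `O(x)` is crudely bounded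
by `O(R log x)`, one easily sees from the triangle inequality that
`𝔼_{n ≤ x} Λ(n+h₁)⋯Λ(n+h_k) λ_Siegel⋯ ≈ 𝔼_{n ≤ x} Λν(n+h₁)⋯Λν(n+h_k) λ_Siegel⋯` (with plenty of
room to spare in the error term)." Here: for fixed shifts `h₁, h₂` and cutoff `ψ` there are `C`,
`η₁` with `|𝔼_{n ≤ x} Λ(n+h₁)Λ(n+h₂) - 𝔼_{n ≤ x} Λν(n+h₁)Λν(n+h₂)| ≤ C / log^{1/20} η` for every
Siegel zero of quality `η ≥ η₁` and conductor `q` and every `x ≥ q` (in particular on the range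
(1.7)), `ν` at level `R = x^{1/log^{1/10} η}`. Proof: the difference is
`≤ (1/x) · O_ψ(log² x) · #{p^j ≤ x + max hᵢ : p < R} = O(R log³ x / x)`, `R ≤ x^{1/2}` for
`log η ≥ 2^{10}`, and `log η ≤ log x + O(1)` by (1.4) (`exists_siegelZero_quality_le`), so the
error times `log^{1/20} η` is `O(log⁴ x / x^{1/2}) = O(1)`. [cite: TaoTeravainen2021, §5 (5.1)] -/
theorem TaoTeravainen2021_eq51_pair (h₁ h₂ : ℕ) {ψ : ℝ → ℝ} (hψ : IsSmoothCutoff ψ) :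
    ∃ C η₁ : ℝ, ∀ (q : ℕ) [NeZero q] (χ : DirichletCharacter ℂ q) (η : ℝ), IsSiegelZero χ η →
      η₁ ≤ η → ∀ x : ℕ, (q : ℝ) ≤ x →
        |vonMangoldtPairAverage h₁ h₂ x -
            pairAverage (sievedVonMangoldt ψ (pairScaleR η x)) h₁ h₂ x| ≤
          C / Real.log η ^ ((1 : ℝ) / 20) := by
  obtain ⟨B, hB0, hB⟩ := hψ.exists_abs_le
  obtain ⟨CS, hCS, hSiegel⟩ := exists_siegelZero_quality_le one_pos
  -- constants
  set K : ℝ := (1 + B) ^ 2 with hK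
  have hK0 : 0 ≤ K := by rw [hK]; positivity
  set H : ℕ := max h₁ h₂ with hH
  have hH0 : (0 : ℝ) ≤ H := Nat.cast_nonneg H
  set cH : ℝ := 1 + Real.log (1 + H) with hcH
  have hlogH : 0 ≤ Real.log (1 + (H : ℝ)) := Real.log_nonneg (by linarith)
  have hcH1 : 1 ≤ cH := by rw [hcH]; linarith
  set cS : ℝ := 1 + |Real.log CS| with hcS
  have hcS1 : 1 ≤ cS := by rw [hcS]; linarith [abs_nonneg (Real.log CS)]
  refine ⟨12 * 16 ^ 4 * (1 + K) ^ 2 * cH ^ 3 * cS, Real.exp 1024,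
    fun q _ χ η hS hη x hqx => ?_⟩
  -- basic sizes
  have hq3 : (3 : ℝ) ≤ q := by exact_mod_cast hS.three_le
  have hx3 : (3 : ℝ) ≤ x := hq3.trans hqx
  have hx1 : (1 : ℝ) ≤ x := by linarith
  have hx0 : (0 : ℝ) < x := by linarith
  have hlogx : 1 ≤ Real.log x :=
    (Real.le_log_iff_exp_le hx0).mpr (by linarith [Real.exp_one_lt_d9])
  have hη0 : 0 < η := (Real.exp_pos _).trans_le hη
  have hlogη : 1024 ≤ Real.log η := by
    rw [← Real.log_exp 1024]
    exact Real.log_le_log (Real.exp_pos _) hη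
  have hlogη0 : 0 < Real.log η := by linarith
  have hL20 : 0 < Real.log η ^ ((1 : ℝ) / 20) := Real.rpow_pos_of_pos hlogη0 _
  -- the level `R`
  set R : ℝ := pairScaleR η x with hRdef
  have hR1 : 1 < R := by
    rw [hRdef]
    unfold pairScaleR
    refine Real.one_lt_rpow (by linarith) ?_
    have := Real.rpow_pos_of_pos hlogη0 ((1 : ℝ) / 10)
    positivity
  have hR0 : 0 ≤ R := by linarith
  have hRsqrt : R ≤ Real.sqrt x := pairScaleR_le_sqrt hη hx1
  have hsqrt1 : 1 ≤ Real.sqrt x := Real.one_le_sqrt.mpr hx1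
  have hsqrt0 : 0 < Real.sqrt x := by linarith
  have hsqrtx : Real.sqrt x * Real.sqrt x = x := Real.mul_self_sqrt hx0.le
  -- `M = x + max hᵢ`, `L = log M ≤ cH log x`
  set M : ℕ := x + H with hMdef
  have hMx : (x : ℝ) ≤ M := by rw [hMdef]; push_cast; linarith
  have hM0 : (0 : ℝ) < M := by linarith
  set L : ℝ := Real.log M with hLdef
  have hL1 : 1 ≤ L := hlogx.trans (Real.log_le_log hx0 hMx)
  have hL0 : 0 ≤ L := by linarith
  have hLle : L ≤ cH * Real.log x := by
    have hMle : (M : ℝ) ≤ (1 + H) * x := by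
      have : (H : ℝ) ≤ H * x := le_mul_of_one_le_right hH0 hx1
      rw [hMdef]
      push_cast
      linarith
    calc L = Real.log M := rfl
      _ ≤ Real.log ((1 + H) * x) := Real.log_le_log hM0 hMle
      _ = Real.log (1 + H) + Real.log x := Real.log_mul (by positivity) hx0.ne'
      _ ≤ Real.log (1 + H) * Real.log x + Real.log x := by
          linarith [le_mul_of_one_le_right hlogH hlogx]
      _ = cH * Real.log x := by rw [hcH]; ring
  have hlogle : ∀ m : ℕ, 1 ≤ m → m ≤ M → Real.log m ≤ L := fun m hm hmM =>
    Real.log_le_log (by exact_mod_cast hm) (by exact_mod_cast hmM)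
  -- counting: `T = (⌊R⌋ + 1)(log₂ M + 1) ≤ 6 √x L`
  set T : ℕ := (⌊R⌋₊ + 1) * (Nat.log 2 M + 1) with hTdef
  have hT : (T : ℝ) ≤ 6 * Real.sqrt x * L := natCount_le hR0 hRsqrt hsqrt1 hL1 le_rfl
  -- the sum of the differences
  have hsum : |∑ n ∈ Icc 1 x, (Λ (n + h₁) * Λ (n + h₂) -
      sievedVonMangoldt ψ R (n + h₁) * sievedVonMangoldt ψ R (n + h₂))| ≤
        12 * (1 + K) ^ 2 * Real.sqrt x * L ^ 3 := by
    have hpt : ∀ n ∈ Icc 1 x,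
        |Λ (n + h₁) * Λ (n + h₂) -
            sievedVonMangoldt ψ R (n + h₁) * sievedVonMangoldt ψ R (n + h₂)| ≤
          (1 + K) ^ 2 * L ^ 2 *
            ((if IsPrimePow (n + h₁) ∧ ((n + h₁).minFac : ℝ) < R then (1 : ℝ) else 0) +
              (if IsPrimePow (n + h₂) ∧ ((n + h₂).minFac : ℝ) < R then (1 : ℝ) else 0)) := by
      intro n hn
      rw [Finset.mem_Icc] at hn
      exact abs_pair_sub_sievedPair_le hψ hB hR1
        (hlogle (n + h₁) (by omega) (by rw [hMdef, hH]; omega))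
        (hlogle (n + h₂) (by omega) (by rw [hMdef, hH]; omega))
    have hc₁ := sum_indicator_primePow_lt_le R (x := x) (h := h₁) (M := M)
      (by rw [hMdef, hH]; omega)
    have hc₂ := sum_indicator_primePow_lt_le R (x := x) (h := h₂) (M := M)
      (by rw [hMdef, hH]; omega)
    calc |∑ n ∈ Icc 1 x, (Λ (n + h₁) * Λ (n + h₂) -
            sievedVonMangoldt ψ R (n + h₁) * sievedVonMangoldt ψ R (n + h₂))|
        ≤ ∑ n ∈ Icc 1 x, |Λ (n + h₁) * Λ (n + h₂) -
            sievedVonMangoldt ψ R (n + h₁) * sievedVonMangoldt ψ R (n + h₂)| :=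
          Finset.abs_sum_le_sum_abs _ _
      _ ≤ ∑ n ∈ Icc 1 x, (1 + K) ^ 2 * L ^ 2 *
            ((if IsPrimePow (n + h₁) ∧ ((n + h₁).minFac : ℝ) < R then (1 : ℝ) else 0) +
              (if IsPrimePow (n + h₂) ∧ ((n + h₂).minFac : ℝ) < R then (1 : ℝ) else 0)) :=
          Finset.sum_le_sum hpt
      _ = (1 + K) ^ 2 * L ^ 2 *
            (∑ n ∈ Icc 1 x, (if IsPrimePow (n + h₁) ∧ ((n + h₁).minFac : ℝ) < R then (1 : ℝ) else 0) +
              ∑ n ∈ Icc 1 x, (if IsPrimePow (n + h₂) ∧ ((n + h₂).minFac : ℝ) < R then (1 : ℝ) else 0)) := by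
          rw [← Finset.sum_add_distrib, Finset.mul_sum]
      _ ≤ (1 + K) ^ 2 * L ^ 2 * ((T : ℝ) + T) := by
          have h0 : 0 ≤ (1 + K) ^ 2 * L ^ 2 := by positivity
          exact mul_le_mul_of_nonneg_left (add_le_add hc₁ hc₂) h0
      _ ≤ (1 + K) ^ 2 * L ^ 2 * (2 * (6 * Real.sqrt x * L)) := by
          have h0 : 0 ≤ (1 + K) ^ 2 * L ^ 2 := by positivity
          exact mul_le_mul_of_nonneg_left (by linarith) h0
      _ = 12 * (1 + K) ^ 2 * Real.sqrt x * L ^ 3 := by ring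
  -- the averages
  have havg : |vonMangoldtPairAverage h₁ h₂ x - pairAverage (sievedVonMangoldt ψ R) h₁ h₂ x| ≤
      12 * (1 + K) ^ 2 * L ^ 3 / Real.sqrt x := by
    unfold vonMangoldtPairAverage pairAverage
    rw [← sub_div, ← Finset.sum_sub_distrib, abs_div, abs_of_pos hx0, div_le_iff₀ hx0,
      div_mul_eq_mul_div, le_div_iff₀ hsqrt0]
    calc |∑ n ∈ Icc 1 x, (Λ (n + h₁) * Λ (n + h₂) -
            sievedVonMangoldt ψ R (n + h₁) * sievedVonMangoldt ψ R (n + h₂))| * Real.sqrt x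
        ≤ (12 * (1 + K) ^ 2 * Real.sqrt x * L ^ 3) * Real.sqrt x :=
          mul_le_mul_of_nonneg_right hsum hsqrt0.le
      _ = 12 * (1 + K) ^ 2 * L ^ 3 * (Real.sqrt x * Real.sqrt x) := by ring
      _ = 12 * (1 + K) ^ 2 * L ^ 3 * x := by rw [hsqrtx]
  -- `log^{1/20} η ≤ log η ≤ cS log x` by (1.4)
  have hηq : η ≤ CS * x := by
    have := hSiegel q χ η hS
    rw [Real.rpow_one] at this
    exact this.trans (mul_le_mul_of_nonneg_left hqx hCS.le)
  have hL20le : Real.log η ^ ((1 : ℝ) / 20) ≤ cS * Real.log x :=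
    rpow_log_le_of_le_mul hη0 hCS hx0 hlogx (by linarith) hηq
  -- `log⁴ x ≤ 16⁴ √x`
  have hlog4 : Real.log x ^ 4 ≤ 16 ^ 4 * Real.sqrt x := log_pow_four_le_sqrt hx1
  -- conclusion
  rw [le_div_iff₀ hL20]
  have hL3 : L ^ 3 ≤ cH ^ 3 * Real.log x ^ 3 := by
    calc L ^ 3 ≤ (cH * Real.log x) ^ 3 := by gcongr
      _ = cH ^ 3 * Real.log x ^ 3 := by ring
  have hP : 0 ≤ 12 * (1 + K) ^ 2 * cH ^ 3 * cS := by positivity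
  calc |vonMangoldtPairAverage h₁ h₂ x - pairAverage (sievedVonMangoldt ψ R) h₁ h₂ x| *
        Real.log η ^ ((1 : ℝ) / 20)
      ≤ (12 * (1 + K) ^ 2 * L ^ 3 / Real.sqrt x) * (cS * Real.log x) :=
        mul_le_mul havg hL20le hL20.le (by positivity)
    _ ≤ (12 * (1 + K) ^ 2 * (cH ^ 3 * Real.log x ^ 3) / Real.sqrt x) * (cS * Real.log x) := by
        gcongr
    _ = 12 * (1 + K) ^ 2 * cH ^ 3 * cS * (Real.log x ^ 4 / Real.sqrt x) := by ring
    _ ≤ 12 * (1 + K) ^ 2 * cH ^ 3 * cS * (16 ^ 4) := by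
        refine mul_le_mul_of_nonneg_left ?_ hP
        rw [div_le_iff₀ hsqrt0]
        exact hlog4
    _ = 12 * 16 ^ 4 * (1 + K) ^ 2 * cH ^ 3 * cS := by ring

namespace TaoTeravainen

/-! ### The objects of Lemma 5.1 (`k = 2`, `ℓ = 0`) -/

/-- The auxiliary scale `R₀ := x^{1/√(log η)}` of (2.5). [cite: TaoTeravainen2021, §2.4 (2.5)] -/
def scaleR0 (η x : ℝ) : ℝ :=
  x ^ (1 / Real.sqrt (Real.log η))

/-- **The majorant `E` of Lemma 5.1** ((5.4)):
`E(n) := (∑_{R₀ < p* ≤ √(2x)} 1_{p* ∣ n} + ∑_{R₀ < p ≤ √(2x)} 1_{p² ∣ n}) τν(n) log x`, where `p*`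
ranges over the EXCEPTIONAL primes ("a prime `p*` such that `χ(p*) ≠ -1`", §2.3), `τ` is the
divisor function and `ν` the Selberg sieve at level `R`. [cite: TaoTeravainen2021, Lemma 5.1 (5.4) and §2.3] -/
def errE {q : ℕ} (χ : DirichletCharacter ℂ q) (ψ : ℝ → ℝ) (R R₀ : ℝ) (x n : ℕ) : ℝ :=
  ((#((Finset.range (n + 1)).filter fun p : ℕ =>
        p.Prime ∧ realChar χ p ≠ -1 ∧ R₀ < (p : ℝ) ∧ (p : ℝ) ≤ Real.sqrt (2 * x) ∧ p ∣ n) : ℝ) +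
      #((Finset.range (n + 1)).filter fun p : ℕ =>
        p.Prime ∧ R₀ < (p : ℝ) ∧ (p : ℝ) ≤ Real.sqrt (2 * x) ∧ p ^ 2 ∣ n)) *
    (n.divisors.card : ℝ) * selbergSieve ψ R n * Real.log x

/-- `E ≥ 0`. [cite: TaoTeravainen2021, Lemma 5.1 (5.4)] -/
theorem errE_nonneg {q : ℕ} (χ : DirichletCharacter ℂ q) (ψ : ℝ → ℝ) (R R₀ : ℝ) (x n : ℕ) :
    0 ≤ errE χ ψ R R₀ x n := by
  unfold errE
  have := selbergSieve_nonneg ψ R n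
  have := Real.log_natCast_nonneg x
  positivity

/-- **The majorant `F` of Lemma 5.1** ((5.5)) with the exponent `O(1)` made a parameter `A`:
`F_A(n) := (∑_{1 < d ≤ D : d ∣ n} τ_{(≤R₀)}(d)^A) ν(n) log x`, where `τ_{(≤R₀)} = τ · 1_{ℕ_{(≤R₀)}}`
is the divisor function restricted to the `R₀`-smooth numbers (§2.3; Mathlib's
`Nat.smoothNumbers (⌊R₀⌋₊ + 1)`). In the source the exponent comes from Landreau's inequality (3.10)
with `D = x^{ε₀/(10(k+ℓ))}`, so it depends on `ε₀` only. [cite: TaoTeravainen2021, Lemma 5.1 (5.5), §2.3 and (3.10)] -/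
def errF (ψ : ℝ → ℝ) (R R₀ D : ℝ) (A : ℕ) (x n : ℕ) : ℝ :=
  (∑ d ∈ n.divisors,
      if 1 < d ∧ (d : ℝ) ≤ D ∧ d ∈ Nat.smoothNumbers (⌊R₀⌋₊ + 1) then ((d.divisors.card : ℕ) : ℝ) ^ A
      else 0) *
    selbergSieve ψ R n * Real.log x

/-- `F_A ≥ 0`. [cite: TaoTeravainen2021, Lemma 5.1 (5.5)] -/
theorem errF_nonneg (ψ : ℝ → ℝ) (R R₀ D : ℝ) (A : ℕ) (x n : ℕ) : 0 ≤ errF ψ R R₀ D A x n := by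
  unfold errF
  refine mul_nonneg (mul_nonneg (Finset.sum_nonneg fun d _ => ?_) (selbergSieve_nonneg ψ R n))
    (Real.log_natCast_nonneg x)
  split_ifs <;> positivity

/-- **The majorant `G` of Lemma 5.1** ((5.6)):
`G(n) := ∑_{√(2x) < p* ≤ 2x/R^{1/2}} 1_{p* ∣ n} Λν(n/p*)` (`p*` exceptional).
[cite: TaoTeravainen2021, Lemma 5.1 (5.6) and §2.3] -/
def errG {q : ℕ} (χ : DirichletCharacter ℂ q) (ψ : ℝ → ℝ) (R : ℝ) (x n : ℕ) : ℝ :=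
  ∑ p ∈ (Finset.range (n + 1)).filter (fun p : ℕ =>
      p.Prime ∧ realChar χ p ≠ -1 ∧ Real.sqrt (2 * x) < (p : ℝ) ∧ (p : ℝ) ≤ 2 * x / Real.sqrt R ∧
        p ∣ n),
    sievedVonMangoldt ψ R (n / p)

/-- `G ≥ 0`. [cite: TaoTeravainen2021, Lemma 5.1 (5.6)] -/
theorem errG_nonneg {q : ℕ} (χ : DirichletCharacter ℂ q) (ψ : ℝ → ℝ) (R : ℝ) (x n : ℕ) :
    0 ≤ errG χ ψ R x n :=
  Finset.sum_nonneg fun p _ => sievedVonMangoldt_nonneg ψ R (n / p)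

/-- `E` at the scales of §2.4 for `k = 2`: `R = x^{1/log^{1/10} η}` (`pairScaleR`),
`R₀ = x^{1/√log η}` (`scaleR0`). [cite: TaoTeravainen2021, Lemma 5.1 (5.4), (2.3), (2.5)] -/
abbrev pairErrE {q : ℕ} (χ : DirichletCharacter ℂ q) (ψ : ℝ → ℝ) (η : ℝ) (x n : ℕ) : ℝ :=
  errE χ ψ (pairScaleR η x) (scaleR0 η x) x n

/-- `F_A` at the scales of §2.4 for `k = 2`, `ℓ = 0`: `R`, `R₀` as in `pairErrE` and
`D = x^{ε₀/(10(k+ℓ))} = x^{ε₀/20}` = `scaleD 2 ε₀ x` (the `k = 0` file's `scaleD ℓ` at `ℓ := k + ℓ = 2`).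
[cite: TaoTeravainen2021, Lemma 5.1 (5.5), (2.3)–(2.5)] -/
abbrev pairErrF (ψ : ℝ → ℝ) (η ε₀ : ℝ) (A : ℕ) (x n : ℕ) : ℝ :=
  errF ψ (pairScaleR η x) (scaleR0 η x) (scaleD 2 ε₀ x) A x n

/-- `G` at the scale `R = x^{1/log^{1/10} η}` of §2.4 for `k = 2`.
[cite: TaoTeravainen2021, Lemma 5.1 (5.6), (2.3)] -/
abbrev pairErrG {q : ℕ} (χ : DirichletCharacter ℂ q) (ψ : ℝ → ℝ) (η : ℝ) (x n : ℕ) : ℝ :=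
  errG χ ψ (pairScaleR η x) x n

/-- The algebra of "Multiplying these estimates together" (proof of Proposition 5.2): if
`|Λν(a) - Λ_S(a)| ≤ C ε(a)` and `|Λν(b) - Λ_S(b)| ≤ C ε(b)` with `ε = E + F + G ≥ 0`, `Λν ≥ 0`,
`C ≥ 1`, then `|Λν(a)Λν(b) - Λ_S(a)Λ_S(b)|` is at most `C²` times the sum of the six integrands of
(5.7), (5.8), (5.9) at `(a, b)` and at `(b, a)` ("By the triangle inequality and relabeling").
[cite: TaoTeravainen2021, proof of Proposition 5.2 (display before (5.7))] -/
theorem abs_mul_sub_mul_le_of_majorants {Na Nb Sa Sb Ea Eb Fa Fb Ga Gb C : ℝ} (hC : 1 ≤ C)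
    (hNa : 0 ≤ Na) (hNb : 0 ≤ Nb) (hEa : 0 ≤ Ea) (hEb : 0 ≤ Eb) (hFa : 0 ≤ Fa) (hFb : 0 ≤ Fb)
    (hGa : 0 ≤ Ga) (hGb : 0 ≤ Gb) (ha : |Na - Sa| ≤ C * (Ea + Fa + Ga))
    (hb : |Nb - Sb| ≤ C * (Eb + Fb + Gb)) :
    |Na * Nb - Sa * Sb| ≤
      C ^ 2 * (Ea * (Nb + Eb + Fb + Gb) + Eb * (Na + Ea + Fa + Ga) + Fa * (Nb + Fb + Gb) +
        Fb * (Na + Fa + Ga) + Ga * (Nb + Gb) + Gb * (Na + Ga)) := by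
  have hεa : 0 ≤ Ea + Fa + Ga := by positivity
  have hεb : 0 ≤ Eb + Fb + Gb := by positivity
  have hC0 : 0 ≤ C := by linarith
  have hCC : C ≤ C ^ 2 := by nlinarith
  have key : Na * Nb - Sa * Sb =
      (Na - Sa) * Nb + Na * (Nb - Sb) - (Na - Sa) * (Nb - Sb) := by ring
  have h1 : |Na * Nb - Sa * Sb| ≤
      C * (Ea + Fa + Ga) * Nb + Na * (C * (Eb + Fb + Gb)) +
        C * (Ea + Fa + Ga) * (C * (Eb + Fb + Gb)) := by
    rw [key]
    calc |(Na - Sa) * Nb + Na * (Nb - Sb) - (Na - Sa) * (Nb - Sb)|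
        ≤ |(Na - Sa) * Nb + Na * (Nb - Sb)| + |(Na - Sa) * (Nb - Sb)| := abs_sub _ _
      _ ≤ |(Na - Sa) * Nb| + |Na * (Nb - Sb)| + |(Na - Sa) * (Nb - Sb)| := by
          linarith [abs_add_le ((Na - Sa) * Nb) (Na * (Nb - Sb))]
      _ = |Na - Sa| * Nb + Na * |Nb - Sb| + |Na - Sa| * |Nb - Sb| := by
          rw [abs_mul, abs_mul, abs_mul, abs_of_nonneg hNb, abs_of_nonneg hNa]
      _ ≤ C * (Ea + Fa + Ga) * Nb + Na * (C * (Eb + Fb + Gb)) +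
            C * (Ea + Fa + Ga) * (C * (Eb + Fb + Gb)) := by
          gcongr
  have h2 : C * (Ea + Fa + Ga) * Nb + Na * (C * (Eb + Fb + Gb)) +
      C * (Ea + Fa + Ga) * (C * (Eb + Fb + Gb)) ≤
      C ^ 2 * ((Ea + Fa + Ga) * Nb + Na * (Eb + Fb + Gb) + (Ea + Fa + Ga) * (Eb + Fb + Gb)) := by
    have t1 : C * (Ea + Fa + Ga) * Nb ≤ C ^ 2 * ((Ea + Fa + Ga) * Nb) := by
      rw [mul_assoc]
      exact mul_le_mul_of_nonneg_right hCC (by positivity)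
    have t2 : Na * (C * (Eb + Fb + Gb)) ≤ C ^ 2 * (Na * (Eb + Fb + Gb)) := by
      rw [show Na * (C * (Eb + Fb + Gb)) = C * (Na * (Eb + Fb + Gb)) by ring]
      exact mul_le_mul_of_nonneg_right hCC (by positivity)
    have t3 : C * (Ea + Fa + Ga) * (C * (Eb + Fb + Gb)) =
        C ^ 2 * ((Ea + Fa + Ga) * (Eb + Fb + Gb)) := by ring
    rw [t3, mul_add, mul_add]
    linarith
  have h3 : (Ea + Fa + Ga) * Nb + Na * (Eb + Fb + Gb) + (Ea + Fa + Ga) * (Eb + Fb + Gb) ≤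
      Ea * (Nb + Eb + Fb + Gb) + Eb * (Na + Ea + Fa + Ga) + Fa * (Nb + Fb + Gb) +
        Fb * (Na + Fa + Ga) + Ga * (Nb + Gb) + Gb * (Na + Ga) := by
    nlinarith [mul_nonneg hEa hEb, mul_nonneg hFa hFb, mul_nonneg hGa hGb]
  calc |Na * Nb - Sa * Sb| ≤ _ := h1
    _ ≤ _ := h2
    _ ≤ _ := mul_le_mul_of_nonneg_left h3 (by positivity)

end TaoTeravainen

/-! ### Lemma 5.1 and the bounds (5.7)–(5.9) at `k = 2`, `ℓ = 0`, as named facts -/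

/-- **Tao–Teräväinen 2022, Lemma 5.1, at the scales of `k = 2`, `ℓ = 0`.** "For `n ≤ 2x`, we
have the bounds `Λν(n) - Λ_Siegel(n) ≪ E(n) + F(n) + G(n)`", `E, F, G` as in (5.4)–(5.6)
(`errE`, `errF`, `errG`), at `R = x^{1/log^{1/10} η}`, `R₀ = x^{1/√log η}`, `D = x^{ε₀/20}`.
Quantifier shape: for a fixed cutoff `ψ` and fixed `0 < ε₀ < 1` there are an exponent `A` (the
`O(1)` of (5.5), from Landreau's inequality (3.10), depending on `ε₀`), a constant `C` and a
threshold `η₁` (standing assumptions of §2.1) such that the bound holds for every Siegel zero of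
quality `η ≥ η₁`, every `x` in the range (1.7) and every `1 ≤ n ≤ 2x`. A NAMED FACT (source
inputs: `χ ∗ log = (1∗χ) ∗ Λ`, the support of `1 ∗ χ`, Landreau's inequality (3.9)–(3.10),
`ν(d) = 0` for `1 < d ≤ R^{1/2}`). [cite: TaoTeravainen2021, Lemma 5.1 (with (5.3)–(5.6), (2.3)–(2.5), §2.1)] -/
def TaoTeravainen2021_lemma51_pair : Prop :=
  ∀ ψ : ℝ → ℝ, IsSmoothCutoff ψ → ∀ ε₀ : ℝ, 0 < ε₀ → ε₀ < 1 →
    ∃ (A : ℕ) (C η₁ : ℝ), ∀ (q : ℕ) [NeZero q] (χ : DirichletCharacter ℂ q) (η : ℝ),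
      IsSiegelZero χ η → η₁ ≤ η →
        ∀ x : ℕ, (q : ℝ) ^ ((41 : ℝ) / 2 + ε₀) ≤ x → (x : ℝ) ≤ (q : ℝ) ^ Real.sqrt η →
          ∀ n : ℕ, 1 ≤ n → n ≤ 2 * x →
            |sievedVonMangoldt ψ (pairScaleR η x) n - vonMangoldtSiegel χ ψ (pairScaleR η x) n| ≤
              C * (pairErrE χ ψ η x n + pairErrF ψ η ε₀ A x n + pairErrG χ ψ η x n)

/-- **Tao–Teräväinen 2022, (5.7) for `k = 2`, `ℓ = 0`**:
"`𝔼_{n ≤ x} E(n+h₁) ∏_{j=2}^k (Λν + E + F + G)(n+h_j) ≈ 0`", i.e. for fixed distinct shifts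
`h₁, h₂ ≥ 1`, a fixed cutoff `ψ`, `ε₀` small enough and any fixed exponent `A` in `F = F_A`, there are
`C`, `η₁` with `𝔼_{n ≤ x} E(n+h₁)(Λν + E + F_A + G)(n+h₂) ≤ C / log^{1/20} η` for every Siegel zero
of quality `η ≥ η₁` and all `x` in the range (1.7) (the average is `≥ 0`). A NAMED FACT (source
inputs: Landreau (3.10), Lemma 3.4, divisor bound, Euler products, Corollary 3.6, (2.8), (2.9)).
[cite: TaoTeravainen2021, proof of Proposition 5.2, (5.7) (with (5.4)–(5.6), (2.3)–(2.6), §2.1)] -/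
def TaoTeravainen2021_eq57_pair : Prop :=
  ∀ h₁ h₂ : ℕ, 1 ≤ h₁ → 1 ≤ h₂ → h₁ ≠ h₂ → ∀ ψ : ℝ → ℝ, IsSmoothCutoff ψ →
    ∃ ε₁ : ℝ, 0 < ε₁ ∧ ∀ ε₀ : ℝ, 0 < ε₀ → ε₀ ≤ ε₁ → ∀ A : ℕ,
      ∃ C η₁ : ℝ, ∀ (q : ℕ) [NeZero q] (χ : DirichletCharacter ℂ q) (η : ℝ), IsSiegelZero χ η →
        η₁ ≤ η → ∀ x : ℕ, (q : ℝ) ^ ((41 : ℝ) / 2 + ε₀) ≤ x → (x : ℝ) ≤ (q : ℝ) ^ Real.sqrt η →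
          (∑ n ∈ Icc 1 x, pairErrE χ ψ η x (n + h₁) *
              (sievedVonMangoldt ψ (pairScaleR η x) (n + h₂) + pairErrE χ ψ η x (n + h₂) +
                pairErrF ψ η ε₀ A x (n + h₂) + pairErrG χ ψ η x (n + h₂))) / x ≤
            C / Real.log η ^ ((1 : ℝ) / 20)

/-- **Tao–Teräväinen 2022, (5.8) for `k = 2`, `ℓ = 0`**:
"`𝔼_{n ≤ x} F(n+h₁) ∏_{j=2}^k (Λν + F + G)(n+h_j) ≈ 0`", same quantifier shape as
`TaoTeravainen2021_eq57_pair`. A NAMED FACT (source inputs: Lemma 3.4, Euler products (5.12), the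
saving `(log_R^k x) log_R R₀ ≈ 0` of (2.8)). [cite: TaoTeravainen2021, proof of Proposition 5.2, (5.8) (with (5.5)–(5.6), (2.3)–(2.6), §2.1)] -/
def TaoTeravainen2021_eq58_pair : Prop :=
  ∀ h₁ h₂ : ℕ, 1 ≤ h₁ → 1 ≤ h₂ → h₁ ≠ h₂ → ∀ ψ : ℝ → ℝ, IsSmoothCutoff ψ →
    ∃ ε₁ : ℝ, 0 < ε₁ ∧ ∀ ε₀ : ℝ, 0 < ε₀ → ε₀ ≤ ε₁ → ∀ A : ℕ,
      ∃ C η₁ : ℝ, ∀ (q : ℕ) [NeZero q] (χ : DirichletCharacter ℂ q) (η : ℝ), IsSiegelZero χ η →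
        η₁ ≤ η → ∀ x : ℕ, (q : ℝ) ^ ((41 : ℝ) / 2 + ε₀) ≤ x → (x : ℝ) ≤ (q : ℝ) ^ Real.sqrt η →
          (∑ n ∈ Icc 1 x, pairErrF ψ η ε₀ A x (n + h₁) *
              (sievedVonMangoldt ψ (pairScaleR η x) (n + h₂) + pairErrF ψ η ε₀ A x (n + h₂) +
                pairErrG χ ψ η x (n + h₂))) / x ≤
            C / Real.log η ^ ((1 : ℝ) / 20)

/-- **Tao–Teräväinen 2022, (5.9) for `k = 2`, `ℓ = 0`**:
"`𝔼_{n ≤ x} G(n+h₁) ∏_{j=2}^k (Λν + G)(n+h_j) ≈ 0`", same quantifier shape (no exponent `A`).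
A NAMED FACT (source inputs: (5.10), Lemma 3.2, Mertens, Corollary 3.6, divisor bound).
[cite: TaoTeravainen2021, proof of Proposition 5.2, (5.9) (with (5.6), (2.3), (2.6), §2.1)] -/
def TaoTeravainen2021_eq59_pair : Prop :=
  ∀ h₁ h₂ : ℕ, 1 ≤ h₁ → 1 ≤ h₂ → h₁ ≠ h₂ → ∀ ψ : ℝ → ℝ, IsSmoothCutoff ψ →
    ∃ ε₁ : ℝ, 0 < ε₁ ∧ ∀ ε₀ : ℝ, 0 < ε₀ → ε₀ ≤ ε₁ →
      ∃ C η₁ : ℝ, ∀ (q : ℕ) [NeZero q] (χ : DirichletCharacter ℂ q) (η : ℝ), IsSiegelZero χ η →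
        η₁ ≤ η → ∀ x : ℕ, (q : ℝ) ^ ((41 : ℝ) / 2 + ε₀) ≤ x → (x : ℝ) ≤ (q : ℝ) ^ Real.sqrt η →
          (∑ n ∈ Icc 1 x, pairErrG χ ψ η x (n + h₁) *
              (sievedVonMangoldt ψ (pairScaleR η x) (n + h₂) + pairErrG χ ψ η x (n + h₂))) / x ≤
            C / Real.log η ^ ((1 : ℝ) / 20)

/-! ### Proposition 5.2 from (5.1), Lemma 5.1 and (5.7)–(5.9), proved -/

/-- **Proposition 5.2 (`k = 2`, `ℓ = 0`) from its inputs** (the proof of Proposition 5.2 as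
printed: "In view of (5.1) it suffices to show that `𝔼 Λν(n+h₁)⋯Λν(n+h_k)⋯ ≈ 𝔼 Λ_Siegel(n+h₁)⋯`
… From (5.3) we have `Λ_Siegel(n+h_j) = Λν(n+h_j) + O(E(n+h_j) + F(n+h_j) + G(n+h_j))` …
Multiplying these estimates together … By the triangle inequality and relabeling, it thus suffices
to establish the bounds (5.7), (5.8), (5.9)"): given the named facts `TaoTeravainen2021_lemma51_pair`,
`_eq57_pair`, `_eq58_pair`, `_eq59_pair` (each used for `(h₁, h₂)` and `(h₂, h₁)`) and the PROVED
insertion `TaoTeravainen2021_eq51_pair`, the fact `TaoTeravainen2021_prop52_pair` holds.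
Bookkeeping: `ε₀` is shrunk below the six thresholds (and `1/2`), `η₁` is the largest of the nine
thresholds and of `C(1) (h₁ + h₂ + 1)` with `C(1)` from (1.4) (so that `x ≥ q > h₁ + h₂` and
Lemma 5.1 applies at `n + hᵢ ≤ 2x`). [cite: TaoTeravainen2021, proof of Proposition 5.2] -/
theorem TaoTeravainen2021_prop52_pair_of_stepTwo (h51 : TaoTeravainen2021_lemma51_pair)
    (h57 : TaoTeravainen2021_eq57_pair) (h58 : TaoTeravainen2021_eq58_pair)
    (h59 : TaoTeravainen2021_eq59_pair) : TaoTeravainen2021_prop52_pair := by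
  intro h₁ h₂ hh₁ hh₂ hne ψ hψ
  obtain ⟨e₁, he₁, H57⟩ := h57 h₁ h₂ hh₁ hh₂ hne ψ hψ
  obtain ⟨e₂, he₂, H57'⟩ := h57 h₂ h₁ hh₂ hh₁ hne.symm ψ hψ
  obtain ⟨e₃, he₃, H58⟩ := h58 h₁ h₂ hh₁ hh₂ hne ψ hψ
  obtain ⟨e₄, he₄, H58'⟩ := h58 h₂ h₁ hh₂ hh₁ hne.symm ψ hψ
  obtain ⟨e₅, he₅, H59⟩ := h59 h₁ h₂ hh₁ hh₂ hne ψ hψ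
  obtain ⟨e₆, he₆, H59'⟩ := h59 h₂ h₁ hh₂ hh₁ hne.symm ψ hψ
  set ε₁ : ℝ := min (min (min e₁ e₂) (min e₃ e₄)) (min (min e₅ e₆) (1 / 2)) with hε₁
  have hε₁pos : 0 < ε₁ := by
    rw [hε₁]
    exact lt_min (lt_min (lt_min he₁ he₂) (lt_min he₃ he₄)) (lt_min (lt_min he₅ he₆) (by norm_num))
  refine ⟨ε₁, hε₁pos, fun ε₀ hε₀ hε₀le => ?_⟩
  have hA : ε₁ ≤ min (min e₁ e₂) (min e₃ e₄) := min_le_left _ _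
  have hB : ε₁ ≤ min (min e₅ e₆) (1 / 2) := min_le_right _ _
  have hε1 : ε₀ ≤ e₁ := hε₀le.trans (hA.trans ((min_le_left _ _).trans (min_le_left _ _)))
  have hε2 : ε₀ ≤ e₂ := hε₀le.trans (hA.trans ((min_le_left _ _).trans (min_le_right _ _)))
  have hε3 : ε₀ ≤ e₃ := hε₀le.trans (hA.trans ((min_le_right _ _).trans (min_le_left _ _)))
  have hε4 : ε₀ ≤ e₄ := hε₀le.trans (hA.trans ((min_le_right _ _).trans (min_le_right _ _)))
  have hε5 : ε₀ ≤ e₅ := hε₀le.trans (hB.trans ((min_le_left _ _).trans (min_le_left _ _)))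
  have hε6 : ε₀ ≤ e₆ := hε₀le.trans (hB.trans ((min_le_left _ _).trans (min_le_right _ _)))
  have hε₀1 : ε₀ < 1 := by
    have : ε₀ ≤ 1 / 2 := hε₀le.trans (hB.trans (min_le_right _ _))
    linarith
  obtain ⟨A, C₀, η₀, K51⟩ := h51 ψ hψ ε₀ hε₀ hε₀1
  obtain ⟨C₁, η₁, K57⟩ := H57 ε₀ hε₀ hε1 A
  obtain ⟨C₂, η₂, K57'⟩ := H57' ε₀ hε₀ hε2 A
  obtain ⟨C₃, η₃, K58⟩ := H58 ε₀ hε₀ hε3 A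
  obtain ⟨C₄, η₄, K58'⟩ := H58' ε₀ hε₀ hε4 A
  obtain ⟨C₅, η₅, K59⟩ := H59 ε₀ hε₀ hε5
  obtain ⟨C₆, η₆, K59'⟩ := H59' ε₀ hε₀ hε6
  obtain ⟨Cν, ην, Kν⟩ := TaoTeravainen2021_eq51_pair h₁ h₂ hψ
  obtain ⟨CS, hCS, hSiegel⟩ := exists_siegelZero_quality_le one_pos
  set C' : ℝ := max C₀ 1 with hC'
  have hC'1 : 1 ≤ C' := le_max_right _ _
  set ηmax : ℝ := max (max (max η₀ ην) (max (max η₁ η₂) (max η₃ η₄)))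
    (max (max η₅ η₆) (CS * (h₁ + h₂ + 1))) with hηmax
  refine ⟨Cν + C' ^ 2 * (C₁ + C₂ + C₃ + C₄ + C₅ + C₆), ηmax, fun q _ χ η hS hη x hlo hhi => ?_⟩
  -- thresholds
  have hL : ηmax ≤ η := hη
  have gA : max (max η₀ ην) (max (max η₁ η₂) (max η₃ η₄)) ≤ η := (le_max_left _ _).trans hL
  have gB : max (max η₅ η₆) (CS * (h₁ + h₂ + 1)) ≤ η := (le_max_right _ _).trans hL
  have gη₀ : η₀ ≤ η := ((le_max_left _ _).trans (le_max_left _ _)).trans gA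
  have gην : ην ≤ η := ((le_max_right _ _).trans (le_max_left _ _)).trans gA
  have gη₁ : η₁ ≤ η := (((le_max_left _ _).trans (le_max_left _ _)).trans (le_max_right _ _)).trans gA
  have gη₂ : η₂ ≤ η := (((le_max_right _ _).trans (le_max_left _ _)).trans (le_max_right _ _)).trans gA
  have gη₃ : η₃ ≤ η := (((le_max_left _ _).trans (le_max_right _ _)).trans (le_max_right _ _)).trans gA
  have gη₄ : η₄ ≤ η := (((le_max_right _ _).trans (le_max_right _ _)).trans (le_max_right _ _)).trans gA
  have gη₅ : η₅ ≤ η := ((le_max_left _ _).trans (le_max_left _ _)).trans gB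
  have gη₆ : η₆ ≤ η := ((le_max_right _ _).trans (le_max_left _ _)).trans gB
  have gS : CS * (h₁ + h₂ + 1) ≤ η := (le_max_right _ _).trans gB
  -- sizes: `x ≥ q`, `x > h₁ + h₂`
  have hq1 : (1 : ℝ) ≤ q := by exact_mod_cast NeZero.one_le
  have hqx : (q : ℝ) ≤ x := by
    calc (q : ℝ) = (q : ℝ) ^ (1 : ℝ) := (Real.rpow_one _).symm
      _ ≤ (q : ℝ) ^ ((41 : ℝ) / 2 + ε₀) := Real.rpow_le_rpow_of_exponent_le hq1 (by linarith)
      _ ≤ x := hlo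
  have hηx : η ≤ CS * x := by
    have := hSiegel q χ η hS
    rw [Real.rpow_one] at this
    exact this.trans (mul_le_mul_of_nonneg_left hqx hCS.le)
  have hxh : (h₁ : ℝ) + h₂ + 1 ≤ x := by
    by_contra hcon
    have : CS * x < CS * (h₁ + h₂ + 1) := mul_lt_mul_of_pos_left (not_le.mp hcon) hCS
    linarith
  have hxh' : h₁ + h₂ + 1 ≤ x := by exact_mod_cast hxh
  have hx0 : (0 : ℝ) < x := by linarith [show (0 : ℝ) ≤ (h₁ : ℝ) + h₂ from by positivity]
  have hη10 : 10 ≤ η := hS.ten_le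
  have hlog : 0 < Real.log η ^ ((1 : ℝ) / 20) := Real.rpow_pos_of_pos (Real.log_pos (by linarith)) _
  -- abbreviations
  set R : ℝ := pairScaleR η x with hRdef
  set N : ℕ → ℝ := fun m => sievedVonMangoldt ψ R m with hNdef
  set S : ℕ → ℝ := fun m => vonMangoldtSiegel χ ψ R m with hSdef
  set E : ℕ → ℝ := fun m => pairErrE χ ψ η x m with hEdef
  set F : ℕ → ℝ := fun m => pairErrF ψ η ε₀ A x m with hFdef
  set G : ℕ → ℝ := fun m => pairErrG χ ψ η x m with hGdef
  have hN0 : ∀ m, 0 ≤ N m := fun m => sievedVonMangoldt_nonneg ψ R m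
  have hE0 : ∀ m, 0 ≤ E m := fun m => errE_nonneg χ ψ _ _ x m
  have hF0 : ∀ m, 0 ≤ F m := fun m => errF_nonneg ψ _ _ _ A x m
  have hG0 : ∀ m, 0 ≤ G m := fun m => errG_nonneg χ ψ _ x m
  -- Lemma 5.1 at `n + h₁`, `n + h₂` (both `≤ 2x`), with the constant `C' ≥ max(C₀, 1)`
  have h51' : ∀ m : ℕ, 1 ≤ m → m ≤ 2 * x → |N m - S m| ≤ C' * (E m + F m + G m) := by
    intro m hm1 hm2
    have := K51 q χ η hS gη₀ x hlo hhi m hm1 hm2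
    refine this.trans (mul_le_mul_of_nonneg_right (le_max_left _ _) ?_)
    exact add_nonneg (add_nonneg (hE0 m) (hF0 m)) (hG0 m)
  -- the six integrands
  set P : ℕ → ℝ := fun n =>
    E (n + h₁) * (N (n + h₂) + E (n + h₂) + F (n + h₂) + G (n + h₂)) +
      E (n + h₂) * (N (n + h₁) + E (n + h₁) + F (n + h₁) + G (n + h₁)) +
      F (n + h₁) * (N (n + h₂) + F (n + h₂) + G (n + h₂)) +
      F (n + h₂) * (N (n + h₁) + F (n + h₁) + G (n + h₁)) +
      G (n + h₁) * (N (n + h₂) + G (n + h₂)) +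
      G (n + h₂) * (N (n + h₁) + G (n + h₁)) with hPdef
  have hpt : ∀ n ∈ Icc 1 x, |N (n + h₁) * N (n + h₂) - S (n + h₁) * S (n + h₂)| ≤ C' ^ 2 * P n := by
    intro n hn
    rw [Finset.mem_Icc] at hn
    exact abs_mul_sub_mul_le_of_majorants hC'1 (hN0 _) (hN0 _) (hE0 _) (hE0 _) (hF0 _) (hF0 _)
      (hG0 _) (hG0 _) (h51' (n + h₁) (by omega) (by omega)) (h51' (n + h₂) (by omega) (by omega))
  -- the six bounds, multiplied through by `x`
  have hdiv : ∀ {T c : ℝ}, T / x ≤ c / Real.log η ^ ((1 : ℝ) / 20) →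
      T ≤ c / Real.log η ^ ((1 : ℝ) / 20) * x := fun h => (div_le_iff₀ hx0).mp h
  have b₁ := hdiv (K57 q χ η hS gη₁ x hlo hhi)
  have b₂ := hdiv (K57' q χ η hS gη₂ x hlo hhi)
  have b₃ := hdiv (K58 q χ η hS gη₃ x hlo hhi)
  have b₄ := hdiv (K58' q χ η hS gη₄ x hlo hhi)
  have b₅ := hdiv (K59 q χ η hS gη₅ x hlo hhi)
  have b₆ := hdiv (K59' q χ η hS gη₆ x hlo hhi)
  have hsumP : ∑ n ∈ Icc 1 x, P n ≤
      (C₁ + C₂ + C₃ + C₄ + C₅ + C₆) / Real.log η ^ ((1 : ℝ) / 20) * x := by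
    have hsplit : ∑ n ∈ Icc 1 x, P n =
        ∑ n ∈ Icc 1 x, E (n + h₁) * (N (n + h₂) + E (n + h₂) + F (n + h₂) + G (n + h₂)) +
        ∑ n ∈ Icc 1 x, E (n + h₂) * (N (n + h₁) + E (n + h₁) + F (n + h₁) + G (n + h₁)) +
        ∑ n ∈ Icc 1 x, F (n + h₁) * (N (n + h₂) + F (n + h₂) + G (n + h₂)) +
        ∑ n ∈ Icc 1 x, F (n + h₂) * (N (n + h₁) + F (n + h₁) + G (n + h₁)) +
        ∑ n ∈ Icc 1 x, G (n + h₁) * (N (n + h₂) + G (n + h₂)) +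
        ∑ n ∈ Icc 1 x, G (n + h₂) * (N (n + h₁) + G (n + h₁)) := by
      simp only [hPdef, Finset.sum_add_distrib]
    rw [hsplit]
    have : (C₁ + C₂ + C₃ + C₄ + C₅ + C₆) / Real.log η ^ ((1 : ℝ) / 20) * x =
        C₁ / Real.log η ^ ((1 : ℝ) / 20) * x + C₂ / Real.log η ^ ((1 : ℝ) / 20) * x +
        C₃ / Real.log η ^ ((1 : ℝ) / 20) * x + C₄ / Real.log η ^ ((1 : ℝ) / 20) * x +
        C₅ / Real.log η ^ ((1 : ℝ) / 20) * x + C₆ / Real.log η ^ ((1 : ℝ) / 20) * x := by ring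
    rw [this]
    exact add_le_add (add_le_add (add_le_add (add_le_add (add_le_add b₁ b₂) b₃) b₄) b₅) b₆
  -- the two averages of `Λν` and `Λ_Siegel`
  have hmid : |pairAverage N h₁ h₂ x - pairAverage S h₁ h₂ x| ≤
      C' ^ 2 * (C₁ + C₂ + C₃ + C₄ + C₅ + C₆) / Real.log η ^ ((1 : ℝ) / 20) := by
    unfold pairAverage
    rw [← sub_div, ← Finset.sum_sub_distrib, abs_div, abs_of_pos hx0, div_le_iff₀ hx0]
    calc |∑ n ∈ Icc 1 x, (N (n + h₁) * N (n + h₂) - S (n + h₁) * S (n + h₂))|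
        ≤ ∑ n ∈ Icc 1 x, |N (n + h₁) * N (n + h₂) - S (n + h₁) * S (n + h₂)| :=
          Finset.abs_sum_le_sum_abs _ _
      _ ≤ ∑ n ∈ Icc 1 x, C' ^ 2 * P n := Finset.sum_le_sum hpt
      _ = C' ^ 2 * ∑ n ∈ Icc 1 x, P n := by rw [Finset.mul_sum]
      _ ≤ C' ^ 2 * ((C₁ + C₂ + C₃ + C₄ + C₅ + C₆) / Real.log η ^ ((1 : ℝ) / 20) * x) :=
          mul_le_mul_of_nonneg_left hsumP (by positivity)
      _ = C' ^ 2 * (C₁ + C₂ + C₃ + C₄ + C₅ + C₆) / Real.log η ^ ((1 : ℝ) / 20) * x := by ring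
  -- (5.1)
  have hins := Kν q χ η hS gην x hqx
  -- conclusion
  have hfinal : |vonMangoldtPairAverage h₁ h₂ x - pairAverage S h₁ h₂ x| ≤
      Cν / Real.log η ^ ((1 : ℝ) / 20) +
        C' ^ 2 * (C₁ + C₂ + C₃ + C₄ + C₅ + C₆) / Real.log η ^ ((1 : ℝ) / 20) :=
    calc |vonMangoldtPairAverage h₁ h₂ x - pairAverage S h₁ h₂ x|
        = |(vonMangoldtPairAverage h₁ h₂ x - pairAverage N h₁ h₂ x) +
            (pairAverage N h₁ h₂ x - pairAverage S h₁ h₂ x)| := by ring_nf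
      _ ≤ |vonMangoldtPairAverage h₁ h₂ x - pairAverage N h₁ h₂ x| +
            |pairAverage N h₁ h₂ x - pairAverage S h₁ h₂ x| := abs_add_le _ _
      _ ≤ _ := add_le_add hins hmid
  calc |vonMangoldtPairAverage h₁ h₂ x - pairAverage (vonMangoldtSiegel χ ψ (pairScaleR η x)) h₁ h₂ x|
      = |vonMangoldtPairAverage h₁ h₂ x - pairAverage S h₁ h₂ x| := rfl
    _ ≤ _ := hfinal
    _ = (Cν + C' ^ 2 * (C₁ + C₂ + C₃ + C₄ + C₅ + C₆)) / Real.log η ^ ((1 : ℝ) / 20) := by ring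

end Literature.Barriers.Parity
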